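import Summits.QuantumFields.YangMills.Theorems.BalabanUVNodesN22W1RelCentredTermDatum214Keyed
import Literature.MathematicalPhysics.QuantumFieldTheory.Balaban1983to89.Node00.HistoryTermIndexedGeneratorTotal

/-!
# BalabanUVNodes ∕ node N22 = NE9 — THE W1 OBJECT ON THE RELATIVE-DISC CENTRED ROAD (RE-TYPING M1′), MODULE R2c: THE LEAF AT THE LITERALLY GENERATED READING — the run towers
# generated by a (2.14) term-datum FAMILY of record through node00-def-W1 g8's TOTAL generator `TermData214.Gn₀` (no positivity instance on the cube size), so the
# identification binder `Gn F θ (ksel …) = 𝔇.Gn` of R2b DISAPPEARS (`Gn₀_eq`, a theorem)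

Cell `pub-ymgap`, HUMAN RULING D-0062 (Track A), R134 ACCELERATION re-seat `pub-ymgap-dag-n22-c` (strategy s1), generation 6, file R2c of the re-typed line.  THEOREMS ONLY; imports R2b
`…N22W1RelCentredTermDatum214Keyed` (§2 `n22_tupleReadingOfRecordSepOn_relCentredTermDatum_of_n18Below`) and node00-def-W1 g8's W1-9 `Node00/HistoryTermIndexedGeneratorTotal`
(`TermData214.Gn₀`, `Gn₀_eq`) BY NAME.  `--supports` K3⁗ `SpineGivenEndpointR13Sep` (stmt-QuantumFields-20292) as a helper.

WHY.  R2b (like 22′ ∕ 24′ ∕ 25′ before it) reads the rate carriers off run towers `runTowers fun k ↦ toClusterTower (Gn F θ k)` for a FREE generator family `Gn` — because `1 ≤ τ9.M` is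
Stage-9 ADMISSIBILITY, not a structure law, so the datum-generated `𝔇.Gn := GenTower.ofTerms L 𝔇.TF` (which needs `NeZero M` through print's term set `terms L M Z`) is not typable over all
`θ` — and carries the identification `Gn F θ (ksel …) = 𝔇.Gn` INSIDE the per-tuple existential.  W1-9's total generator `𝔇.Gn₀ := GenTower.ofTerms₀ L 𝔇.TF` (empty term set at `M = 0`,
`= 𝔇.Gn` at positive `M`: `Gn₀_eq`) makes the reading LITERALLY generated by a (2.14) term-datum family of record `𝔇 F θ k` (socket constants `c F θ k`, coarse factor `L F θ k` given as
families): THIS FILE is R2b §2 at `Gn := fun F θ k ↦ (𝔇 F θ k).Gn₀`, the identification discharged by `Gn₀_eq` under the tuple's `NeZero θ.τ9.M`.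

WHAT.  ★ `n22_tupleReadingOfRecordSepOn_relCentredTermDatum₀_of_n18Below` (guarded by any `Rg`) · ★ `n22_tupleReadingOfRecordSep_relCentredTermDatum₀_of_n18Below` (unguarded): N22's conjunct
of `KeyedRates rr` at `rr := rateCarriersOfRecord₁₃Sep (readingOfRecord₁₃Sep (fun F θ ↦ ReadingData.ofRecordAdm F θ.τ9.M N (runTowers fun k ↦ toClusterTower ((𝔇 F θ k).Gn₀)) …) ℓ₃ ne2 ne1) F θ hP
g₀ os (ksel F θ g₀ os)` ⇐ node N18 below `ksel` at the same reading + signs + per `(F, θ, g₀, os)` ∃(`NeZero θ.τ9.M`, `Sg`, `Rz`, `cs`, letters, a continued family `TFc`, a centre `V`, a domain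
family `D`): the R2 data for the datum `𝔇 F θ (ksel …)` (table inclusion, numerals at `a₅′`, slack, S25, renewal, relative discs, smallness, real-window agreement, (S-last-T′), (S-226-T′) for
`TFc` and `V`, (S-vertex-T′) below `ksel`).

HONEST FRAMING.  Count-neutral by-name knit; NOT a discharge of N22, NOT a closer of `stub_rates13`; ONE conjunct of `KeyedRates`.  The term-datum family `𝔇` is DATA (NODE 00's datum of
record is not yet typed from def-B13's kernels); every schema DISPLAYED; (S-vertex-T′) NOT PRINTED; node N18 below is N18's; no inhabitant of `IsDatumOfRecord₁₃CSep` ∕ admissible tuple claimed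
(K0⁗ OPEN); vacuous where `AdmBg … = ∅`.  NE9 NOT IN PRINT for d = 4; one finite four-torus programme at fixed ε — NOT infinite volume, NOT OS on ℝ⁴, NOT a mass gap, NOT Clay.  0 `sorry`,
0 `def`, standard axioms.

References (TYPES only): [I] = [Balaban1987RG1] (0.23)–(0.25) pp. 256–257, §1 p. 263, (2.9)–(2.10) pp. 266–267, (2.13) p. 268; [II] = [Balaban1988RG2Cluster] (1.41) p. 11,
(2.9)–(2.15) pp. 14–16, (2.26) p. 17, Lemma 3 p. 20, (2.39)–(2.41) p. 21.
-/

noncomputable section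

open scoped Matrix.Norms.L2Operator

namespace YMDAG.N22.W1

open Set Metric
open scoped BigOperators
open Literature.MathematicalPhysics.QuantumFieldTheory.Balaban1983to89
open Literature.MathematicalPhysics.QuantumFieldTheory.Balaban1983to89.T4Continuum
open Literature.MathematicalPhysics.QuantumFieldTheory.Balaban1983to89.T4OutputRate
open Literature.MathematicalPhysics.QuantumFieldTheory.Balaban1983to89.TreeLengthTorus (TPt TDom tsys torusTreeLen torusTreeLen_nonneg)
open Literature.MathematicalPhysics.QuantumFieldTheory.Balaban1983to89.B12TreeDecay (K₀ K₀_pos)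
open Literature.MathematicalPhysics.QuantumFieldTheory.Balaban1983to89.B13Lemma3TorusData (TBond)
open Literature.MathematicalPhysics.QuantumFieldTheory.Balaban1983to89.B13Lemma3TorusTerms (terms weight weight_nonneg)
open Literature.MathematicalPhysics.QuantumFieldTheory.Balaban1983to89.B13Lemma3TorusSocket (Lemma3Numerics)
open Literature.MathematicalPhysics.QuantumFieldTheory.Balaban1983to89.Step (SFConsts)
open Literature.MathematicalPhysics.QuantumFieldTheory.Balaban1983to89.Node00
  (Stage12Params Stage13Params U3Objects₁₁ U3Letters₁₁ NE2Objects₁₁ NE3Letters₁₁ MatA ιSU prependCoupling)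
open Literature.MathematicalPhysics.QuantumFieldTheory.Balaban1983to89.Node00.Sect2 (domSys domCount CPair ofBackgroundC spaceI domSites Setting Residual)
open Literature.MathematicalPhysics.QuantumFieldTheory.Balaban1983to89.Node00.W1
open YMDAG.UVSplit

variable {N : ℕ} [NeZero N]

section Generated

variable (c : (F : T4Family) → Stage13Params F N → ℕ → B13.Consts) (L : (F : T4Family) → Stage13Params F N → ℕ → ℕ) [hL : ∀ F θ k, NeZero (L F θ k)]
  (𝔇 : (F : T4Family) → (θ : Stage13Params F N) → (k : ℕ) → TermData214 (c F θ k) (F.P k) (MatA N) θ.τ9.M (L F θ k))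
  (sp : (F : T4Family) → (θ : Stage13Params F N) → (k j : ℕ) → (domSys (F.P k) θ.τ9.M j).Dom → Set (CPair (F.P k) (MatA N)))
  (gauge : (F : T4Family) → (θ : Stage13Params F N) → (k : ℕ) → GaugeField (F.P k) 0 (Node00.SU N) → GaugeField (F.P k) 0 (Node00.SU N) → ℝ)
  (hg : ∀ (F : T4Family) (θ : Stage13Params F N) (k : ℕ) (U U' : GaugeField (F.P k) 0 (Node00.SU N)), 0 ≤ gauge F θ k U U')
  (T₀ : (F : T4Family) → (θ : Stage13Params F N) → (k : ℕ) → GaugeField (F.P (k + 1)) 0 (Node00.SU N) → GaugeField (F.P k) 0 (Node00.SU N))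
  (hT : ∀ (F : T4Family) (θ : Stage13Params F N) (k : ℕ) (U : GaugeField (F.P (k + 1)) 0 (Node00.SU N)),
    (∀ (j : ℕ) (Y : (domSys (F.P (k + 1)) θ.τ9.M j).Dom), ofBackgroundC (ιSU N) U ∈ sp F θ (k + 1) j Y) →
      ∀ (j : ℕ) (X : (domSys (F.P k) θ.τ9.M j).Dom), ofBackgroundC (ιSU N) (T₀ F θ k U) ∈ sp F θ k j X)
  (li : (F : T4Family) → Stage13Params F N → LetterInputs) (ℓ₃ : T4Family → NE3Letters₁₁)
  (ne2 : (F : T4Family) → Stage13Params F N → (ℕ → ℝ) → List (ULoop F) → ℕ → NE2Objects₁₁)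
  (ne1 : (F : T4Family) → Stage13Params F N → (ℕ → ℝ) → List (ULoop F) → NE1pCarriers)
  (ksel : (F : T4Family) → Stage13Params F N → (ℕ → ℝ) → List (ULoop F) → ℕ)
  (Rg : (F : T4Family) → Stage13Params F N → Prop) {G : Type*} [GaugeGroup G]

open Classical in
/-- **N22's CONJUNCT OF `KeyedRates rr` AT THE LITERALLY GENERATED TUPLE READING OF RECORD (Sep EDITION), GUARDED BY ANY REGIME `Rg`** — R2b §2 at `Gn := fun F θ k ↦ (𝔇 F θ k).Gn₀`
(W1-9's TOTAL generator of the (2.14) term-datum family of record; the identification `(𝔇 F θ k).Gn₀ = (𝔇 F θ k).Gn` is `TermData214.Gn₀_eq` under the tuple's `NeZero θ.τ9.M`): node N18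
below `ksel` + signs + per `(F, θ, g₀, os)` in the regime ∃(`NeZero θ.τ9.M`, `Sg`, `Rz`, `cs`, letters `a a₂ a₂′ a₅ a₅′ Aabs r₁ E₀ Mv cA`, continued family `TFc`, centre `V`, domain family
`D`): the R2 data for the datum `𝔇 F θ (ksel …)`.  ONE conjunct — NOT a closer of `stub_rates13`.
[cite: Balaban1988RG2Cluster, (1.41) p.11, (2.9)-(2.15) pp.14-16, (2.26) p.17, Lemma 3 p.20 and (2.39)-(2.41) p.21; Balaban1987RG1, (0.23)-(0.25) pp.256-257, §1 p.263, (2.9)-(2.10) pp.266-267 and (2.13) p.268] -/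
theorem n22_tupleReadingOfRecordSepOn_relCentredTermDatum₀_of_n18Below
    (h18 : ∀ (F : T4Family) (θ : Stage13Params F N) (hP : θ.Provisos₁₃Sep F N), Rg F θ → θ.Admissible F N → ∀ (g₀ : ℕ → ℝ) (os : List (ULoop F)),
      ∀ k' : ℕ, k' < ksel F θ g₀ os → N18At (u3OfRecord₁₃ θ ((ReadingData.ofRecordAdm F θ.τ9.M N (runTowers fun k => toClusterTower ((𝔇 F θ k).Gn₀)) (sp F θ)
        (gauge F θ) (hg F θ) (T₀ F θ) (hT F θ) (li F θ)).u3Objects θ.γ) k'))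
    (hnum : ∀ (F : T4Family) (θ : Stage13Params F N), θ.Provisos₁₃Sep F N → Rg F θ → θ.Admissible F N →
      0 < (li F θ).C₀ ∧ 0 < (li F θ).θ₅ ∧ (li F θ).θ₅ < 1 ∧ 0 ≤ (li F θ).C₅ ∧ 2 * (li F θ).C₅ / (1 - (li F θ).θ₅) ≤ (li F θ).C₀ ∧ 0 < (li F θ).A ∧
        (li F θ).μ = 1 ∧ 0 < (li F θ).r ∧ (li F θ).s = (2 : ℝ)⁻¹)
    (hdata : ∀ (F : T4Family) (θ : Stage13Params F N), θ.Provisos₁₃Sep F N → Rg F θ → θ.Admissible F N → ∀ (g₀ : ℕ → ℝ) (os : List (ULoop F)),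
      ∃ (_ : NeZero θ.τ9.M) (Sg : Setting (MatA N) G) (Rz : Residual (F.P (ksel F θ g₀ os)) (MatA N))
        (cs : SFConsts) (a a₂ a₂' a₅ a₅' Aabs r₁ E₀ Mv cA : ℝ) (TFc : GenTermFun (F.P (ksel F θ g₀ os)) (MatA N) θ.τ9.M (L F θ (ksel F θ g₀ os)))
        (V : (k' : ℕ) → (domSys (F.P (ksel F θ g₀ os)) θ.τ9.M (k' + 1)).Dom → TermLabel (F.P (ksel F θ g₀ os)) θ.τ9.M k' (L F θ (ksel F θ g₀ os)) →
          OlderTerms (F.P (ksel F θ g₀ os)) (MatA N) θ.τ9.M k' → CPair (F.P (ksel F θ g₀ os)) (MatA N) → ℂ)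
        (D : ℕ → Set ℂ),
        (∀ (j : ℕ) (Y : (domSys (F.P (ksel F θ g₀ os)) θ.τ9.M j).Dom),
          sp F θ (ksel F θ g₀ os) j Y ⊆ spaceI Sg Rz θ.τ9.M j (domSites (F.P (ksel F θ g₀ os)) θ.τ9.M j Y) cs.α₀ cs.α₁) ∧
        8 ≤ (c F θ (ksel F θ g₀ os)).L ∧ (c F θ (ksel F θ g₀ os)).L = L F θ (ksel F θ g₀ os) ∧
        Lemma3Numerics (c F θ (ksel F θ g₀ os)) θ.τ9.M (((c F θ (ksel F θ g₀ os)).L : ℝ) / 2) a a₂ a₂' a₅' Aabs ∧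
        0 ≤ (c F θ (ksel F θ g₀ os)).C3act * (c F θ (ksel F θ g₀ os)).ε₁ ∧ 0 ≤ r₁ ∧ (li F θ).κ ≤ r₁ ∧
        r₁ + 2 * (64 * Real.log 162) + 2 ≤ (1 - 8 * (c F θ (ksel F θ g₀ os)).δ) * (((c F θ (ksel F θ g₀ os)).L : ℝ) / 2) * (c F θ (ksel F θ g₀ os)).κ ∧
        (c F θ (ksel F θ g₀ os)).C3act * (c F θ (ksel F θ g₀ os)).ε₁ * Real.exp (5 * r₁ + 1) * K₀ 64 8 * 9 * 64 ≤ 1 ∧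
        Real.exp 1 * 9 * 64 * K₀ 64 8 ^ 2 * ((c F θ (ksel F θ g₀ os)).C3act * (c F θ (ksel F θ g₀ os)).ε₁) ≤ E₀ ∧
        (∀ (k' : ℕ) (Z : (domSys (F.P (ksel F θ g₀ os)) θ.τ9.M (k' + 1)).Dom), 2 * Real.exp (a₅ * ((Z.1).card : ℝ)) ≤ Real.exp (a₅' * ((Z.1).card : ℝ))) ∧
        (∀ i, IsOpen (D i)) ∧ (∀ (i : ℕ), ∀ t ∈ Ioc (0 : ℝ) θ.γ, ((t : ℝ) : ℂ) ∈ D i) ∧ (∀ (i : ℕ), ∀ t ∈ Ioc (0 : ℝ) θ.γ, closedBall (t : ℂ) (cA * t) ⊆ D i) ∧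
        0 < cA ∧ cA < 1 ∧ 0 < Mv ∧ Mv * ((1 + cA) * θ.γ) ^ 2 ≤ 1 / 2 ∧ 2 * Mv * E₀ * (1 + cA) ^ 2 ≤ (li F θ).A ∧ (li F θ).r ≤ min cA 1 ∧
        (∀ (k' : ℕ) (Z : (domSys (F.P (ksel F θ g₀ os)) θ.τ9.M (k' + 1)).Dom) (t : TermLabel (F.P (ksel F θ g₀ os)) θ.τ9.M k' (L F θ (ksel F θ g₀ os))) (s : ℝ),
          s ∈ Ioc (0 : ℝ) θ.γ → ∀ (old : OlderTerms (F.P (ksel F θ g₀ os)) (MatA N) θ.τ9.M k') (φ : CPair (F.P (ksel F θ g₀ os)) (MatA N)),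
            TFc k' Z t (s : ℂ) old φ = (𝔇 F θ (ksel F θ g₀ os) k').TF Z t (s : ℂ) old φ) ∧
        (∀ k' : ℕ, k' < ksel F θ g₀ os → ∀ old : OlderTerms (F.P (ksel F θ g₀ os)) (MatA N) θ.τ9.M k',
          (∀ (j : Fin (k' + 1)) (Y : (domSys (F.P (ksel F θ g₀ os)) θ.τ9.M j).Dom) (ψ : CPair (F.P (ksel F θ g₀ os)) (MatA N)),
              ψ ∈ spaceI Sg Rz θ.τ9.M j (domSites (F.P (ksel F θ g₀ os)) θ.τ9.M j Y) cs.α₀ cs.α₁ → ‖old j Y ψ‖ ≤ E₀ * Real.exp (-((li F θ).κ * torusTreeLen Y.1))) →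
          ∀ (X : (domSys (F.P (ksel F θ g₀ os)) θ.τ9.M (k' + 1)).Dom) (φ : CPair (F.P (ksel F θ g₀ os)) (MatA N)),
            φ ∈ spaceI Sg Rz θ.τ9.M (k' + 1) (domSites (F.P (ksel F θ g₀ os)) θ.τ9.M (k' + 1) X) cs.α₀ cs.α₁ →
            ∀ (Z : (domSys (F.P (ksel F θ g₀ os)) θ.τ9.M (k' + 1)).Dom), Z.1 ⊆ X.1 → ∀ t ∈ terms (L F θ (ksel F θ g₀ os)) θ.τ9.M Z,
              DifferentiableOn ℂ (fun z => TFc k' Z t z old φ) (D k') ∧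
                ∀ z ∈ D k', ‖TFc k' Z t z old φ‖ ≤ weight (L F θ (ksel F θ g₀ os)) θ.τ9.M (c F θ (ksel F θ g₀ os)) Z a t * Real.exp (a₅ * ((Z.1).card : ℝ))) ∧
        (∀ k' : ℕ, k' < ksel F θ g₀ os → ∀ i : ℕ, i < k' → ∀ (O : Set ℂ), IsOpen O → ∀ u ∈ D k', ∀ cv : ℂ → OlderTerms (F.P (ksel F θ g₀ os)) (MatA N) θ.τ9.M k',
          (∀ (j : Fin (k' + 1)) (Y : (domSys (F.P (ksel F θ g₀ os)) θ.τ9.M j).Dom) (ψ : CPair (F.P (ksel F θ g₀ os)) (MatA N)),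
              ψ ∈ spaceI Sg Rz θ.τ9.M j (domSites (F.P (ksel F θ g₀ os)) θ.τ9.M j Y) cs.α₀ cs.α₁ →
              DifferentiableOn ℂ (fun z => cv z j Y ψ) O ∧ ∀ z ∈ O, ‖cv z j Y ψ‖ ≤ E₀ * Real.exp (-((li F θ).κ * torusTreeLen Y.1))) →
          ∀ (X : (domSys (F.P (ksel F θ g₀ os)) θ.τ9.M (k' + 1)).Dom) (φ : CPair (F.P (ksel F θ g₀ os)) (MatA N)),
            φ ∈ spaceI Sg Rz θ.τ9.M (k' + 1) (domSites (F.P (ksel F θ g₀ os)) θ.τ9.M (k' + 1) X) cs.α₀ cs.α₁ →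
            ∀ (Z : (domSys (F.P (ksel F θ g₀ os)) θ.τ9.M (k' + 1)).Dom), Z.1 ⊆ X.1 → ∀ t ∈ terms (L F θ (ksel F θ g₀ os)) θ.τ9.M Z,
              DifferentiableOn ℂ (fun z => TFc k' Z t u (cv z) φ) O ∧
                ∀ z ∈ O, ‖TFc k' Z t u (cv z) φ‖ ≤ weight (L F θ (ksel F θ g₀ os)) θ.τ9.M (c F θ (ksel F θ g₀ os)) Z a t * Real.exp (a₅ * ((Z.1).card : ℝ))) ∧
        (∀ k' : ℕ, k' < ksel F θ g₀ os → ∀ (O : Set ℂ), IsOpen O → ∀ cv : ℂ → OlderTerms (F.P (ksel F θ g₀ os)) (MatA N) θ.τ9.M k',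
          (∀ (j : Fin (k' + 1)) (Y : (domSys (F.P (ksel F θ g₀ os)) θ.τ9.M j).Dom) (ψ : CPair (F.P (ksel F θ g₀ os)) (MatA N)),
              ψ ∈ spaceI Sg Rz θ.τ9.M j (domSites (F.P (ksel F θ g₀ os)) θ.τ9.M j Y) cs.α₀ cs.α₁ →
              DifferentiableOn ℂ (fun z => cv z j Y ψ) O ∧ ∀ z ∈ O, ‖cv z j Y ψ‖ ≤ E₀ * Real.exp (-((li F θ).κ * torusTreeLen Y.1))) →
          ∀ (X : (domSys (F.P (ksel F θ g₀ os)) θ.τ9.M (k' + 1)).Dom) (φ : CPair (F.P (ksel F θ g₀ os)) (MatA N)),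
            φ ∈ spaceI Sg Rz θ.τ9.M (k' + 1) (domSites (F.P (ksel F θ g₀ os)) θ.τ9.M (k' + 1) X) cs.α₀ cs.α₁ →
            ∀ (Z : (domSys (F.P (ksel F θ g₀ os)) θ.τ9.M (k' + 1)).Dom), Z.1 ⊆ X.1 → ∀ t ∈ terms (L F θ (ksel F θ g₀ os)) θ.τ9.M Z,
              DifferentiableOn ℂ (fun z => V k' Z t (cv z) φ) O ∧
                ∀ z ∈ O, ‖V k' Z t (cv z) φ‖ ≤ weight (L F θ (ksel F θ g₀ os)) θ.τ9.M (c F θ (ksel F θ g₀ os)) Z a t * Real.exp (a₅ * ((Z.1).card : ℝ))) ∧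
        (∀ k' : ℕ, k' < ksel F θ g₀ os → ∀ old : OlderTerms (F.P (ksel F θ g₀ os)) (MatA N) θ.τ9.M k',
          (∀ (j : Fin (k' + 1)) (Y : (domSys (F.P (ksel F θ g₀ os)) θ.τ9.M j).Dom) (ψ : CPair (F.P (ksel F θ g₀ os)) (MatA N)),
              ψ ∈ spaceI Sg Rz θ.τ9.M j (domSites (F.P (ksel F θ g₀ os)) θ.τ9.M j Y) cs.α₀ cs.α₁ → ‖old j Y ψ‖ ≤ E₀ * Real.exp (-((li F θ).κ * torusTreeLen Y.1))) →
          ∀ (X : (domSys (F.P (ksel F θ g₀ os)) θ.τ9.M (k' + 1)).Dom) (φ : CPair (F.P (ksel F θ g₀ os)) (MatA N)),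
            φ ∈ spaceI Sg Rz θ.τ9.M (k' + 1) (domSites (F.P (ksel F θ g₀ os)) θ.τ9.M (k' + 1) X) cs.α₀ cs.α₁ →
            ∀ (Z : (domSys (F.P (ksel F θ g₀ os)) θ.τ9.M (k' + 1)).Dom), Z.1 ⊆ X.1 → ∀ t ∈ terms (L F θ (ksel F θ g₀ os)) θ.τ9.M Z, ∀ z ∈ D k',
              ‖TFc k' Z t z old φ - V k' Z t old φ‖ ≤
                Mv * ‖z‖ ^ 2 * (weight (L F θ (ksel F θ g₀ os)) θ.τ9.M (c F θ (ksel F θ g₀ os)) Z a t * Real.exp (a₅ * ((Z.1).card : ℝ))))) :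
    ∀ (F : T4Family) (θ : Stage13Params F N) (hP : θ.Provisos₁₃Sep F N), Rg F θ → θ.Admissible F N → ∀ (g₀ : ℕ → ℝ) (os : List (ULoop F)),
      N22At (rateCarriersOfRecord₁₃Sep (readingOfRecord₁₃Sep (fun F θ => ReadingData.ofRecordAdm F θ.τ9.M N (runTowers fun k => toClusterTower ((𝔇 F θ k).Gn₀)) (sp F θ)
        (gauge F θ) (hg F θ) (T₀ F θ) (hT F θ) (li F θ)) ℓ₃ ne2 ne1) F θ hP g₀ os (ksel F θ g₀ os)).u3 := by
  refine n22_tupleReadingOfRecordSepOn_relCentredTermDatum_of_n18Below (fun F θ k => (𝔇 F θ k).Gn₀) sp gauge hg T₀ hT li ℓ₃ ne2 ne1 ksel Rg (G := G) h18 hnum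
    fun F θ hP hRg hθ g₀ os => ?_
  obtain ⟨hMz, Sg, Rz, cs, a, a₂, a₂', a₅, a₅', Aabs, r₁, E₀, Mv, cA, TFc, V, D, hspk, hrest⟩ := hdata F θ hP hRg hθ g₀ os
  exact ⟨hMz, Sg, Rz, cs, c F θ (ksel F θ g₀ os), L F θ (ksel F θ g₀ os), hL F θ (ksel F θ g₀ os), a, a₂, a₂', a₅, a₅', Aabs, r₁, E₀, Mv, cA, 𝔇 F θ (ksel F θ g₀ os), TFc, V, D,
    TermData214.Gn₀_eq (𝔇 F θ (ksel F θ g₀ os)), hspk, hrest⟩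

open Classical in
/-- **… UNGUARDED** (the skeleton's binder verbatim; the guarded form at `Rg := fun _ _ ↦ True`).
[cite: Balaban1988RG2Cluster, (2.9)-(2.15) pp.14-16, (2.26) p.17, Lemma 3 p.20 and (2.39)-(2.41) p.21; Balaban1987RG1, (0.23)-(0.25) pp.256-257, §1 p.263 and (2.13) p.268] -/
theorem n22_tupleReadingOfRecordSep_relCentredTermDatum₀_of_n18Below
    (h18 : ∀ (F : T4Family) (θ : Stage13Params F N) (hP : θ.Provisos₁₃Sep F N), θ.Admissible F N → ∀ (g₀ : ℕ → ℝ) (os : List (ULoop F)),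
      ∀ k' : ℕ, k' < ksel F θ g₀ os → N18At (u3OfRecord₁₃ θ ((ReadingData.ofRecordAdm F θ.τ9.M N (runTowers fun k => toClusterTower ((𝔇 F θ k).Gn₀)) (sp F θ)
        (gauge F θ) (hg F θ) (T₀ F θ) (hT F θ) (li F θ)).u3Objects θ.γ) k'))
    (hnum : ∀ (F : T4Family) (θ : Stage13Params F N), θ.Provisos₁₃Sep F N → θ.Admissible F N →
      0 < (li F θ).C₀ ∧ 0 < (li F θ).θ₅ ∧ (li F θ).θ₅ < 1 ∧ 0 ≤ (li F θ).C₅ ∧ 2 * (li F θ).C₅ / (1 - (li F θ).θ₅) ≤ (li F θ).C₀ ∧ 0 < (li F θ).A ∧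
        (li F θ).μ = 1 ∧ 0 < (li F θ).r ∧ (li F θ).s = (2 : ℝ)⁻¹)
    (hdata : ∀ (F : T4Family) (θ : Stage13Params F N), θ.Provisos₁₃Sep F N → θ.Admissible F N → ∀ (g₀ : ℕ → ℝ) (os : List (ULoop F)),
      ∃ (_ : NeZero θ.τ9.M) (Sg : Setting (MatA N) G) (Rz : Residual (F.P (ksel F θ g₀ os)) (MatA N))
        (cs : SFConsts) (a a₂ a₂' a₅ a₅' Aabs r₁ E₀ Mv cA : ℝ) (TFc : GenTermFun (F.P (ksel F θ g₀ os)) (MatA N) θ.τ9.M (L F θ (ksel F θ g₀ os)))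
        (V : (k' : ℕ) → (domSys (F.P (ksel F θ g₀ os)) θ.τ9.M (k' + 1)).Dom → TermLabel (F.P (ksel F θ g₀ os)) θ.τ9.M k' (L F θ (ksel F θ g₀ os)) →
          OlderTerms (F.P (ksel F θ g₀ os)) (MatA N) θ.τ9.M k' → CPair (F.P (ksel F θ g₀ os)) (MatA N) → ℂ)
        (D : ℕ → Set ℂ),
        (∀ (j : ℕ) (Y : (domSys (F.P (ksel F θ g₀ os)) θ.τ9.M j).Dom),
          sp F θ (ksel F θ g₀ os) j Y ⊆ spaceI Sg Rz θ.τ9.M j (domSites (F.P (ksel F θ g₀ os)) θ.τ9.M j Y) cs.α₀ cs.α₁) ∧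
        8 ≤ (c F θ (ksel F θ g₀ os)).L ∧ (c F θ (ksel F θ g₀ os)).L = L F θ (ksel F θ g₀ os) ∧
        Lemma3Numerics (c F θ (ksel F θ g₀ os)) θ.τ9.M (((c F θ (ksel F θ g₀ os)).L : ℝ) / 2) a a₂ a₂' a₅' Aabs ∧
        0 ≤ (c F θ (ksel F θ g₀ os)).C3act * (c F θ (ksel F θ g₀ os)).ε₁ ∧ 0 ≤ r₁ ∧ (li F θ).κ ≤ r₁ ∧
        r₁ + 2 * (64 * Real.log 162) + 2 ≤ (1 - 8 * (c F θ (ksel F θ g₀ os)).δ) * (((c F θ (ksel F θ g₀ os)).L : ℝ) / 2) * (c F θ (ksel F θ g₀ os)).κ ∧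
        (c F θ (ksel F θ g₀ os)).C3act * (c F θ (ksel F θ g₀ os)).ε₁ * Real.exp (5 * r₁ + 1) * K₀ 64 8 * 9 * 64 ≤ 1 ∧
        Real.exp 1 * 9 * 64 * K₀ 64 8 ^ 2 * ((c F θ (ksel F θ g₀ os)).C3act * (c F θ (ksel F θ g₀ os)).ε₁) ≤ E₀ ∧
        (∀ (k' : ℕ) (Z : (domSys (F.P (ksel F θ g₀ os)) θ.τ9.M (k' + 1)).Dom), 2 * Real.exp (a₅ * ((Z.1).card : ℝ)) ≤ Real.exp (a₅' * ((Z.1).card : ℝ))) ∧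
        (∀ i, IsOpen (D i)) ∧ (∀ (i : ℕ), ∀ t ∈ Ioc (0 : ℝ) θ.γ, ((t : ℝ) : ℂ) ∈ D i) ∧ (∀ (i : ℕ), ∀ t ∈ Ioc (0 : ℝ) θ.γ, closedBall (t : ℂ) (cA * t) ⊆ D i) ∧
        0 < cA ∧ cA < 1 ∧ 0 < Mv ∧ Mv * ((1 + cA) * θ.γ) ^ 2 ≤ 1 / 2 ∧ 2 * Mv * E₀ * (1 + cA) ^ 2 ≤ (li F θ).A ∧ (li F θ).r ≤ min cA 1 ∧
        (∀ (k' : ℕ) (Z : (domSys (F.P (ksel F θ g₀ os)) θ.τ9.M (k' + 1)).Dom) (t : TermLabel (F.P (ksel F θ g₀ os)) θ.τ9.M k' (L F θ (ksel F θ g₀ os))) (s : ℝ),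
          s ∈ Ioc (0 : ℝ) θ.γ → ∀ (old : OlderTerms (F.P (ksel F θ g₀ os)) (MatA N) θ.τ9.M k') (φ : CPair (F.P (ksel F θ g₀ os)) (MatA N)),
            TFc k' Z t (s : ℂ) old φ = (𝔇 F θ (ksel F θ g₀ os) k').TF Z t (s : ℂ) old φ) ∧
        (∀ k' : ℕ, k' < ksel F θ g₀ os → ∀ old : OlderTerms (F.P (ksel F θ g₀ os)) (MatA N) θ.τ9.M k',
          (∀ (j : Fin (k' + 1)) (Y : (domSys (F.P (ksel F θ g₀ os)) θ.τ9.M j).Dom) (ψ : CPair (F.P (ksel F θ g₀ os)) (MatA N)),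
              ψ ∈ spaceI Sg Rz θ.τ9.M j (domSites (F.P (ksel F θ g₀ os)) θ.τ9.M j Y) cs.α₀ cs.α₁ → ‖old j Y ψ‖ ≤ E₀ * Real.exp (-((li F θ).κ * torusTreeLen Y.1))) →
          ∀ (X : (domSys (F.P (ksel F θ g₀ os)) θ.τ9.M (k' + 1)).Dom) (φ : CPair (F.P (ksel F θ g₀ os)) (MatA N)),
            φ ∈ spaceI Sg Rz θ.τ9.M (k' + 1) (domSites (F.P (ksel F θ g₀ os)) θ.τ9.M (k' + 1) X) cs.α₀ cs.α₁ →
            ∀ (Z : (domSys (F.P (ksel F θ g₀ os)) θ.τ9.M (k' + 1)).Dom), Z.1 ⊆ X.1 → ∀ t ∈ terms (L F θ (ksel F θ g₀ os)) θ.τ9.M Z,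
              DifferentiableOn ℂ (fun z => TFc k' Z t z old φ) (D k') ∧
                ∀ z ∈ D k', ‖TFc k' Z t z old φ‖ ≤ weight (L F θ (ksel F θ g₀ os)) θ.τ9.M (c F θ (ksel F θ g₀ os)) Z a t * Real.exp (a₅ * ((Z.1).card : ℝ))) ∧
        (∀ k' : ℕ, k' < ksel F θ g₀ os → ∀ i : ℕ, i < k' → ∀ (O : Set ℂ), IsOpen O → ∀ u ∈ D k', ∀ cv : ℂ → OlderTerms (F.P (ksel F θ g₀ os)) (MatA N) θ.τ9.M k',
          (∀ (j : Fin (k' + 1)) (Y : (domSys (F.P (ksel F θ g₀ os)) θ.τ9.M j).Dom) (ψ : CPair (F.P (ksel F θ g₀ os)) (MatA N)),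
              ψ ∈ spaceI Sg Rz θ.τ9.M j (domSites (F.P (ksel F θ g₀ os)) θ.τ9.M j Y) cs.α₀ cs.α₁ →
              DifferentiableOn ℂ (fun z => cv z j Y ψ) O ∧ ∀ z ∈ O, ‖cv z j Y ψ‖ ≤ E₀ * Real.exp (-((li F θ).κ * torusTreeLen Y.1))) →
          ∀ (X : (domSys (F.P (ksel F θ g₀ os)) θ.τ9.M (k' + 1)).Dom) (φ : CPair (F.P (ksel F θ g₀ os)) (MatA N)),
            φ ∈ spaceI Sg Rz θ.τ9.M (k' + 1) (domSites (F.P (ksel F θ g₀ os)) θ.τ9.M (k' + 1) X) cs.α₀ cs.α₁ →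
            ∀ (Z : (domSys (F.P (ksel F θ g₀ os)) θ.τ9.M (k' + 1)).Dom), Z.1 ⊆ X.1 → ∀ t ∈ terms (L F θ (ksel F θ g₀ os)) θ.τ9.M Z,
              DifferentiableOn ℂ (fun z => TFc k' Z t u (cv z) φ) O ∧
                ∀ z ∈ O, ‖TFc k' Z t u (cv z) φ‖ ≤ weight (L F θ (ksel F θ g₀ os)) θ.τ9.M (c F θ (ksel F θ g₀ os)) Z a t * Real.exp (a₅ * ((Z.1).card : ℝ))) ∧
        (∀ k' : ℕ, k' < ksel F θ g₀ os → ∀ (O : Set ℂ), IsOpen O → ∀ cv : ℂ → OlderTerms (F.P (ksel F θ g₀ os)) (MatA N) θ.τ9.M k',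
          (∀ (j : Fin (k' + 1)) (Y : (domSys (F.P (ksel F θ g₀ os)) θ.τ9.M j).Dom) (ψ : CPair (F.P (ksel F θ g₀ os)) (MatA N)),
              ψ ∈ spaceI Sg Rz θ.τ9.M j (domSites (F.P (ksel F θ g₀ os)) θ.τ9.M j Y) cs.α₀ cs.α₁ →
              DifferentiableOn ℂ (fun z => cv z j Y ψ) O ∧ ∀ z ∈ O, ‖cv z j Y ψ‖ ≤ E₀ * Real.exp (-((li F θ).κ * torusTreeLen Y.1))) →
          ∀ (X : (domSys (F.P (ksel F θ g₀ os)) θ.τ9.M (k' + 1)).Dom) (φ : CPair (F.P (ksel F θ g₀ os)) (MatA N)),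
            φ ∈ spaceI Sg Rz θ.τ9.M (k' + 1) (domSites (F.P (ksel F θ g₀ os)) θ.τ9.M (k' + 1) X) cs.α₀ cs.α₁ →
            ∀ (Z : (domSys (F.P (ksel F θ g₀ os)) θ.τ9.M (k' + 1)).Dom), Z.1 ⊆ X.1 → ∀ t ∈ terms (L F θ (ksel F θ g₀ os)) θ.τ9.M Z,
              DifferentiableOn ℂ (fun z => V k' Z t (cv z) φ) O ∧
                ∀ z ∈ O, ‖V k' Z t (cv z) φ‖ ≤ weight (L F θ (ksel F θ g₀ os)) θ.τ9.M (c F θ (ksel F θ g₀ os)) Z a t * Real.exp (a₅ * ((Z.1).card : ℝ))) ∧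
        (∀ k' : ℕ, k' < ksel F θ g₀ os → ∀ old : OlderTerms (F.P (ksel F θ g₀ os)) (MatA N) θ.τ9.M k',
          (∀ (j : Fin (k' + 1)) (Y : (domSys (F.P (ksel F θ g₀ os)) θ.τ9.M j).Dom) (ψ : CPair (F.P (ksel F θ g₀ os)) (MatA N)),
              ψ ∈ spaceI Sg Rz θ.τ9.M j (domSites (F.P (ksel F θ g₀ os)) θ.τ9.M j Y) cs.α₀ cs.α₁ → ‖old j Y ψ‖ ≤ E₀ * Real.exp (-((li F θ).κ * torusTreeLen Y.1))) →
          ∀ (X : (domSys (F.P (ksel F θ g₀ os)) θ.τ9.M (k' + 1)).Dom) (φ : CPair (F.P (ksel F θ g₀ os)) (MatA N)),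
            φ ∈ spaceI Sg Rz θ.τ9.M (k' + 1) (domSites (F.P (ksel F θ g₀ os)) θ.τ9.M (k' + 1) X) cs.α₀ cs.α₁ →
            ∀ (Z : (domSys (F.P (ksel F θ g₀ os)) θ.τ9.M (k' + 1)).Dom), Z.1 ⊆ X.1 → ∀ t ∈ terms (L F θ (ksel F θ g₀ os)) θ.τ9.M Z, ∀ z ∈ D k',
              ‖TFc k' Z t z old φ - V k' Z t old φ‖ ≤
                Mv * ‖z‖ ^ 2 * (weight (L F θ (ksel F θ g₀ os)) θ.τ9.M (c F θ (ksel F θ g₀ os)) Z a t * Real.exp (a₅ * ((Z.1).card : ℝ))))) :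
    ∀ (F : T4Family) (θ : Stage13Params F N) (hP : θ.Provisos₁₃Sep F N), θ.Admissible F N → ∀ (g₀ : ℕ → ℝ) (os : List (ULoop F)),
      N22At (rateCarriersOfRecord₁₃Sep (readingOfRecord₁₃Sep (fun F θ => ReadingData.ofRecordAdm F θ.τ9.M N (runTowers fun k => toClusterTower ((𝔇 F θ k).Gn₀)) (sp F θ)
        (gauge F θ) (hg F θ) (T₀ F θ) (hT F θ) (li F θ)) ℓ₃ ne2 ne1) F θ hP g₀ os (ksel F θ g₀ os)).u3 :=
  fun F θ hP hθ g₀ os =>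
    n22_tupleReadingOfRecordSepOn_relCentredTermDatum₀_of_n18Below c L 𝔇 sp gauge hg T₀ hT li ℓ₃ ne2 ne1 ksel (fun _ _ => True) (G := G)
      (fun F θ hP _ hθ => h18 F θ hP hθ) (fun F θ hP _ hθ => hnum F θ hP hθ) (fun F θ hP _ hθ => hdata F θ hP hθ) F θ hP trivial hθ g₀ os

end Generated

end YMDAG.N22.W1

end
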